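import Summits.MatrixMultiplication.MatrixMultiplication.Theorems.LevelGradedCohnUmansLevelOneGL2DesignsTangencyUnipotentSymmetryClassification

/-!
# Tangency sets with a unipotent symmetry are Paley lifts — wall-breaker axis
`Hermitian unital constructions` for the packing stub `stub_tangencySets` of the crux
`LevelOneGL2Designs` (stmt-MatrixMultiplication-14080, route `LevelGradedCohnUmans`), part III:
the residual in the stub's quantifier shape

Parts I–II: an affine tangency set of `AG(2,p)` (`p` odd) with a symmetry of order `p` has
`≤ p + 1` points or is a parabola pencil over a Paley coclique.  This file states the consequence
in the exact `∃ c > 0, ∀ p₀, ∃ p ≥ p₀ prime, …` shape of `stub_tangencySets`: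

* `paleyCocliques_of_symmetric_tangencySets` — `p`-symmetric tangency sets with `≥ c·p^{3/2}`
  points for unboundedly many primes ⇒ Paley cocliques of size `c·√p` for unboundedly many primes
  (the hypothesis of `ParabolaLift.tangencySets_of_large_cocliques` verbatim, same constant);
* `symmetric_tangencySets_of_paleyCocliques` — conversely, the parabola pencil over a coclique is
  a tangency set with `p·|S|` points invariant under the shear `(x, y) ↦ (x + 1, y + 2x + 1)` of
  order `p` (`shearMatrix_pow_prime`);
* `symmetric_tangencySets_iff_paleyCocliques` — so the `p`-SYMMETRIC VERSION OF THE STUB IS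
  EQUIVALENT TO THE PALEY COCLIQUE PROBLEM, constants preserved both ways;
* `stub_tangencySets_of_symmetric_tangencySets` — and it implies the stub (through the lift);
* `card_of_iterate_eq_id` (appendix) — the main theorem of part II with the symmetry given as a
  bijection `g = (M, t)` of order `p` in the literal sense `g^[p] = id`, `g ≠ id`.

Verdict of the axis for the planner: a "unital-like" (unipotent-symmetric) witness of
`stub_tangencySets` exists iff `α(P_p) ≥ c√p` along a sequence of primes `p ≡ 1 (4)`; the latter is
open, is `≤ √(p/2) + 1` (Hanson–Petridis 2021), and is expected to be false.  Together with the
sibling classifications of torus-symmetric tangency sets (`HermitianUnital.…`, `NormPencil.…`: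
again Paley cliques/cocliques, or `≤ 2` levels) this exhausts the symmetric constructions
suggested by the Hermitian unital; the unconditional records (`p^{5/4}` for every prime, in tree;
`p^{3/2 − ε}` along `p ≡ ±1 (r)`, Pohoata arXiv:2607.20422) all come from symmetry-free lifts.
All statements are elementary and fully proved; no definitions, no named facts.
-/

set_option linter.dupNamespace false

noncomputable section

open Finset Matrix

namespace Summit.MatrixMultiplication.MatrixMultiplication.Theorems.LevelOneGL2Designs.UnipotentSymmetry

variable {p : ℕ} [Fact p.Prime]

omit [Fact p.Prime] in
/-- `p^{3/2} = p · p^{1/2}` for the real power. [elementary] -/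
theorem rpow_three_halves_eq (hp0 : (0 : ℝ) < p) :
    (p : ℝ) ^ (3 / 2 : ℝ) = p * (p : ℝ) ^ (1 / 2 : ℝ) := by
  rw [show (3 / 2 : ℝ) = 1 + 1 / 2 by norm_num, Real.rpow_add hp0, Real.rpow_one]

/-- The shear `(x, y) ↦ (x + 1, y + 2x + 1)` of the parabola pencil `y = x² + s`: its linear part
`M = [[1,0],[2,1]]` acts by `M (x, y) = (x, 2x + y)`. [elementary] -/
theorem shearMatrix_mulVec (v : Fin 2 → ZMod p) :
    !![(1 : ZMod p), 0; 2, 1] *ᵥ v = ![v 0, 2 * v 0 + v 1] := by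
  refine vec2_ext ?_ ?_
  · simp [Matrix.mulVec, dotProduct, Fin.sum_univ_two]
  · simp [Matrix.mulVec, dotProduct, Fin.sum_univ_two]

/-- Powers of the shear matrix: `M^k = [[1,0],[2k,1]]`. [elementary] -/
theorem shearMatrix_pow (k : ℕ) :
    (!![(1 : ZMod p), 0; 2, 1]) ^ k = !![(1 : ZMod p), 0; 2 * k, 1] := by
  induction k with
  | zero =>
    rw [pow_zero, Matrix.one_fin_two]
    simp
  | succ k ih =>
    rw [pow_succ, ih, Matrix.mul_fin_two]
    simp only [mul_one, mul_zero, add_zero, one_mul, zero_add, Nat.cast_succ]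
    ring_nf

/-- The shear matrix has order `p`: `M^p = 1` over `𝔽_p`. [elementary] -/
theorem shearMatrix_pow_prime : (!![(1 : ZMod p), 0; 2, 1]) ^ p = 1 := by
  rw [shearMatrix_pow, ZMod.natCast_self, mul_zero]
  ext i j
  fin_cases i <;> fin_cases j <;> simp

/-- **Residual of the axis, forward direction (in the stub's quantifier shape).**  If for some
`c > 0` and unboundedly many primes `p` there is an affine tangency set of `AG(2,p)` with at least
`c·p^{3/2}` points admitting a symmetry of order `p` (an affinity `v ↦ Mv + t ≠ id` with
`M^p = 1`), then Paley cocliques of size `c·√p` exist for unboundedly many primes — the hypothesis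
of `ParabolaLift.tangencySets_of_large_cocliques` verbatim, with the SAME constant.  (For
`p ≥ 16/c²` the alternative `|V| ≤ p + 1` of `card_of_pow_prime_symmetry` is impossible, so
`|V| = p·|I|`.) [elementary] -/
theorem paleyCocliques_of_symmetric_tangencySets
    (H : ∃ c : ℝ, 0 < c ∧ ∀ p₀ : ℕ, ∃ (p : ℕ) (_ : Fact p.Prime), p₀ ≤ p ∧
      ∃ (M : Matrix (Fin 2) (Fin 2) (ZMod p)) (t : Fin 2 → ZMod p) (V : Finset (Fin 2 → ZMod p)),
        M ^ p = 1 ∧ (M ≠ 1 ∨ t ≠ 0) ∧ (∀ v ∈ V, M *ᵥ v + t ∈ V) ∧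
        (∀ v ∈ V, ∃ u : Fin 2 → ZMod p, u ≠ 0 ∧ ∀ w ∈ V, u ⬝ᵥ w = u ⬝ᵥ v → w = v) ∧
        c * (p : ℝ) ^ (3 / 2 : ℝ) ≤ V.card) :
    ∃ c : ℝ, 0 < c ∧ ∀ p₀ : ℕ, ∃ (p : ℕ) (_ : Fact p.Prime), p₀ ≤ p ∧
      ∃ S : Finset (ZMod p), c * (p : ℝ) ^ (1 / 2 : ℝ) ≤ S.card ∧
        ∀ s ∈ S, ∀ s' ∈ S, s ≠ s' → ¬ IsSquare (s - s') := by
  obtain ⟨c, hc, hH⟩ := H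
  refine ⟨c, hc, fun p₀ => ?_⟩
  obtain ⟨p₁, hp₁⟩ := exists_nat_ge (16 / c ^ 2)
  obtain ⟨p, hp, hpge, M, t, V, hM, hne, hinv, hV, hbig⟩ := hH (max (max p₀ p₁) 3)
  have hp₀ : p₀ ≤ p := (le_max_left _ _).trans ((le_max_left _ _).trans hpge)
  have hpp₁ : p₁ ≤ p := (le_max_right _ _).trans ((le_max_left _ _).trans hpge)
  have hp3 : 3 ≤ p := (le_max_right _ _).trans hpge
  have hp2 : p ≠ 2 := by omega
  have hp0 : (0 : ℝ) < p := by exact_mod_cast (show 0 < p by omega)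
  have hsqrt : 4 / c ≤ (p : ℝ) ^ (1 / 2 : ℝ) := by
    rw [← Real.sqrt_eq_rpow]
    refine Real.le_sqrt_of_sq_le ?_
    calc (4 / c) ^ 2 = 16 / c ^ 2 := by ring
      _ ≤ (p₁ : ℝ) := hp₁
      _ ≤ (p : ℝ) := by exact_mod_cast hpp₁
  rw [rpow_three_halves_eq hp0] at hbig
  rcases card_of_pow_prime_symmetry V hV hp2 M t hM hne hinv with hsmall | ⟨I, hI, hVI⟩
  · exfalso
    have h1 : (V.card : ℝ) ≤ p + 1 := by exact_mod_cast hsmall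
    have h2 : (p : ℝ) * (c * (4 / c)) ≤ p * (c * (p : ℝ) ^ (1 / 2 : ℝ)) := by gcongr
    have h3 : (p : ℝ) * (c * (4 / c)) = 4 * p := by field_simp
    have hp3' : (3 : ℝ) ≤ p := by exact_mod_cast hp3
    nlinarith
  · refine ⟨p, hp, hp₀, I, ?_, hI⟩
    have hVI' : (V.card : ℝ) = p * I.card := by exact_mod_cast hVI
    have h : (p : ℝ) * (c * (p : ℝ) ^ (1 / 2 : ℝ)) ≤ p * I.card := by nlinarith
    exact le_of_mul_le_mul_left h hp0

/-- **Residual of the axis, backward direction.**  Conversely, a Paley coclique `S ⊆ 𝔽_p` lifts to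
the parabola pencil `{(t, t² + s)}`, an affine tangency set with `p·|S|` points
(`ParabolaLift.parabolaPencil_isTangencySet_iff`) invariant under the shear
`(x, y) ↦ (x + 1, y + 2x + 1)` of order `p`; so Paley cocliques of size `c·√p` for unboundedly many
primes give `p`-symmetric tangency sets of size `c·p^{3/2}` for unboundedly many primes, with the
same constant. [elementary] -/
theorem symmetric_tangencySets_of_paleyCocliques
    (H : ∃ c : ℝ, 0 < c ∧ ∀ p₀ : ℕ, ∃ (p : ℕ) (_ : Fact p.Prime), p₀ ≤ p ∧
      ∃ S : Finset (ZMod p), c * (p : ℝ) ^ (1 / 2 : ℝ) ≤ S.card ∧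
        ∀ s ∈ S, ∀ s' ∈ S, s ≠ s' → ¬ IsSquare (s - s')) :
    ∃ c : ℝ, 0 < c ∧ ∀ p₀ : ℕ, ∃ (p : ℕ) (_ : Fact p.Prime), p₀ ≤ p ∧
      ∃ (M : Matrix (Fin 2) (Fin 2) (ZMod p)) (t : Fin 2 → ZMod p) (V : Finset (Fin 2 → ZMod p)),
        M ^ p = 1 ∧ (M ≠ 1 ∨ t ≠ 0) ∧ (∀ v ∈ V, M *ᵥ v + t ∈ V) ∧
        (∀ v ∈ V, ∃ u : Fin 2 → ZMod p, u ≠ 0 ∧ ∀ w ∈ V, u ⬝ᵥ w = u ⬝ᵥ v → w = v) ∧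
        c * (p : ℝ) ^ (3 / 2 : ℝ) ≤ V.card := by
  classical
  obtain ⟨c, hc, hH⟩ := H
  refine ⟨c, hc, fun p₀ => ?_⟩
  obtain ⟨p, hp, hp₀, S, hS, hco⟩ := hH p₀
  let P : ZMod p × ZMod p → (Fin 2 → ZMod p) := fun ts => ![ts.1, ts.1 ^ 2 + ts.2]
  have hPinj : Function.Injective P := by
    rintro ⟨x, s⟩ ⟨x', s'⟩ h
    have h0 : x = x' := by simpa [P] using congr_fun h 0
    have h1 : x ^ 2 + s = x' ^ 2 + s' := by simpa [P] using congr_fun h 1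
    subst h0
    exact Prod.ext rfl (add_left_cancel h1)
  refine ⟨p, hp, hp₀, !![(1 : ZMod p), 0; 2, 1], ![1, 1], (univ ×ˢ S).image P,
    shearMatrix_pow_prime, Or.inr ?_, ?_, ?_, ?_⟩
  · intro h
    simpa using congr_fun h 0
  · intro v hv
    obtain ⟨⟨x, s⟩, hxs, rfl⟩ := mem_image.mp hv
    rw [mem_product] at hxs
    have hmem : P (x + 1, s) ∈ (univ ×ˢ S).image P :=
      mem_image_of_mem _ (mem_product.mpr ⟨mem_univ _, hxs.2⟩)
    convert hmem using 1
    rw [shearMatrix_mulVec]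
    refine vec2_ext ?_ ?_
    · simp [P]
    · simp [P]
      ring
  · have htan := (ParabolaLift.parabolaPencil_isTangencySet_iff S).mpr (Or.inr hco)
    intro v hv
    obtain ⟨⟨x₀, s₀⟩, hxs₀, rfl⟩ := mem_image.mp hv
    rw [mem_product] at hxs₀
    obtain ⟨a, ha0, ha⟩ := htan s₀ hxs₀.2 x₀
    refine ⟨a, ha0, fun w hw heq => ?_⟩
    obtain ⟨⟨x, s⟩, hxs, rfl⟩ := mem_image.mp hw
    rw [mem_product] at hxs
    obtain ⟨rfl, rfl⟩ := ha x s hxs.2 heq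
    rfl
  · rw [card_image_of_injective _ hPinj, card_product, card_univ, ZMod.card]
    have hp0 : (0 : ℝ) < p := by exact_mod_cast hp.out.pos
    rw [rpow_three_halves_eq hp0]
    push_cast
    calc c * ((p : ℝ) * (p : ℝ) ^ (1 / 2 : ℝ)) = p * (c * (p : ℝ) ^ (1 / 2 : ℝ)) := by ring
      _ ≤ p * S.card := by gcongr

/-- **The `p`-symmetric tangency problem IS the Paley coclique problem** (packaging of the two
directions, constants preserved both ways): affine tangency sets of `AG(2,p)` with a symmetry of
order `p` and `≥ c·p^{3/2}` points exist for unboundedly many primes iff Paley cocliques of order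
`√p` do.  The right-hand side is the hypothesis under which `stub_tangencySets` is already known
(`ParabolaLift.tangencySets_of_large_cocliques`) and is expected to be false
(`ω(P_p) = p^{o(1)}`); so the unipotent-symmetric ("unital-like") sub-world of the stub carries no
information beyond the Paley clique number. [elementary] -/
theorem symmetric_tangencySets_iff_paleyCocliques :
    (∃ c : ℝ, 0 < c ∧ ∀ p₀ : ℕ, ∃ (p : ℕ) (_ : Fact p.Prime), p₀ ≤ p ∧
      ∃ (M : Matrix (Fin 2) (Fin 2) (ZMod p)) (t : Fin 2 → ZMod p) (V : Finset (Fin 2 → ZMod p)),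
        M ^ p = 1 ∧ (M ≠ 1 ∨ t ≠ 0) ∧ (∀ v ∈ V, M *ᵥ v + t ∈ V) ∧
        (∀ v ∈ V, ∃ u : Fin 2 → ZMod p, u ≠ 0 ∧ ∀ w ∈ V, u ⬝ᵥ w = u ⬝ᵥ v → w = v) ∧
        c * (p : ℝ) ^ (3 / 2 : ℝ) ≤ V.card) ↔
    (∃ c : ℝ, 0 < c ∧ ∀ p₀ : ℕ, ∃ (p : ℕ) (_ : Fact p.Prime), p₀ ≤ p ∧
      ∃ S : Finset (ZMod p), c * (p : ℝ) ^ (1 / 2 : ℝ) ≤ S.card ∧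
        ∀ s ∈ S, ∀ s' ∈ S, s ≠ s' → ¬ IsSquare (s - s')) :=
  ⟨paleyCocliques_of_symmetric_tangencySets, symmetric_tangencySets_of_paleyCocliques⟩

/-- **The stub from `p`-symmetric tangency sets** (for the record: the symmetric sub-problem is
neither easier nor harder than the stub's known sufficient condition): `p`-symmetric tangency sets
of size `c·p^{3/2}` for unboundedly many primes give `stub_tangencySets` verbatim, through Paley
cocliques and the parabola lift. [elementary] -/
theorem stub_tangencySets_of_symmetric_tangencySets
    (H : ∃ c : ℝ, 0 < c ∧ ∀ p₀ : ℕ, ∃ (p : ℕ) (_ : Fact p.Prime), p₀ ≤ p ∧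
      ∃ (M : Matrix (Fin 2) (Fin 2) (ZMod p)) (t : Fin 2 → ZMod p) (V : Finset (Fin 2 → ZMod p)),
        M ^ p = 1 ∧ (M ≠ 1 ∨ t ≠ 0) ∧ (∀ v ∈ V, M *ᵥ v + t ∈ V) ∧
        (∀ v ∈ V, ∃ u : Fin 2 → ZMod p, u ≠ 0 ∧ ∀ w ∈ V, u ⬝ᵥ w = u ⬝ᵥ v → w = v) ∧
        c * (p : ℝ) ^ (3 / 2 : ℝ) ≤ V.card) :
    ∃ c : ℝ, 0 < c ∧ ∀ p₀ : ℕ, ∃ (p : ℕ) (_ : Fact p.Prime), p₀ ≤ p ∧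
      ∃ S : Finset ((Fin 2 → ZMod p) × (Fin 2 → ZMod p)),
        c * (p : ℝ) ^ (3 / 2 : ℝ) ≤ S.card ∧
        ∀ f ∈ S, ∀ f' ∈ S, (dotProduct f.1 f'.2 = 1 ↔ f = f') :=
  ParabolaLift.tangencySets_of_large_cocliques (paleyCocliques_of_symmetric_tangencySets H)

/-- Iterates of an affinity `g = (M, t)`: `g^[k] v = M^k v + s_k` for some translation part `s_k`.
[elementary] -/
theorem exists_iterate_affine (M : Matrix (Fin 2) (Fin 2) (ZMod p)) (t : Fin 2 → ZMod p)
    (g : (Fin 2 → ZMod p) → (Fin 2 → ZMod p)) (hg : ∀ v, g v = M *ᵥ v + t) (k : ℕ) :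
    ∃ s : Fin 2 → ZMod p, ∀ v, g^[k] v = (M ^ k) *ᵥ v + s := by
  induction k with
  | zero => exact ⟨0, fun v => by simp⟩
  | succ k ih =>
    obtain ⟨s, hs⟩ := ih
    refine ⟨(M ^ k) *ᵥ t + s, fun v => ?_⟩
    rw [Function.iterate_succ_apply, hs, hg, Matrix.mulVec_add, Matrix.mulVec_mulVec, ← pow_succ,
      add_assoc]

/-- **Main theorem, bijection form.**  Let `p` be an odd prime and `g` an affinity of `AG(2,p)`
(`g v = Mv + t`) OF ORDER `p` in the literal sense `g^[p] = id`, `g ≠ id`.  An affine tangency set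
invariant under `g` has `≤ p + 1` points or is a parabola pencil over a Paley coclique `I`,
`|V| = p·|I|` (`card_of_pow_prime_symmetry`, after reading off `M^p = 1` from `g^[p] = id`).
[elementary] -/
theorem card_of_iterate_eq_id (V : Finset (Fin 2 → ZMod p))
    (hV : ∀ v ∈ V, ∃ u : Fin 2 → ZMod p, u ≠ 0 ∧ ∀ w ∈ V, u ⬝ᵥ w = u ⬝ᵥ v → w = v)
    (hp2 : p ≠ 2) (M : Matrix (Fin 2) (Fin 2) (ZMod p)) (t : Fin 2 → ZMod p)
    (g : (Fin 2 → ZMod p) → (Fin 2 → ZMod p)) (hg : ∀ v, g v = M *ᵥ v + t)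
    (hgp : g^[p] = id) (hne : g ≠ id) (hinv : ∀ v ∈ V, g v ∈ V) :
    V.card ≤ p + 1 ∨ ∃ I : Finset (ZMod p), (∀ x ∈ I, ∀ y ∈ I, x ≠ y → ¬ IsSquare (x - y)) ∧
      V.card = p * I.card := by
  obtain ⟨s, hs⟩ := exists_iterate_affine M t g hg p
  have hs0 : s = 0 := by
    have h := hs 0
    rw [hgp, Matrix.mulVec_zero, zero_add] at h
    exact h.symm
  have hM : M ^ p = 1 := by
    refine Matrix.ext_iff_mulVec.mpr fun v => ?_
    have h := hs v
    rw [hgp, hs0, add_zero, id] at h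
    rw [Matrix.one_mulVec]
    exact h.symm
  have hne' : M ≠ 1 ∨ t ≠ 0 := by
    by_contra hcon
    push Not at hcon
    obtain ⟨hM1, ht⟩ := hcon
    apply hne
    funext v
    rw [hg, hM1, ht, Matrix.one_mulVec, add_zero, id]
  refine card_of_pow_prime_symmetry V hV hp2 M t hM hne' fun v hv => ?_
  rw [← hg]
  exact hinv v hv

end Summit.MatrixMultiplication.MatrixMultiplication.Theorems.LevelOneGL2Designs.UnipotentSymmetry

end
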